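import Summits.QuantumAdvantage.QuantumAdvantage.Theses.LinnikCubicClassGroups
import Literature.Computability.Cryptography.CubicClassStageParams

/-!
# Crux `LinnikCubicClassGroups.PureCubicClassGroupFBQP` (stmt-QuantumAdvantage-11544) — the parameter inequalities of the class-group stage

Line `arakelov-giant-step-cycle`, stub `stub_classStageAssembly` (S5b-ASM), helper: every cross-constraint on the explicit
parameters of `Literature/Computability/Cryptography/CubicClassStageParams.lean` that the assembly feeds to
`ClassTableInterfaceQ3`, `ClaimSamplingLaw`, `ClaimPost` and to its `11/12` error budget, from the size bounds of the
input (`a, b, m < 2^(n+1)`, `1 ≤ m`, `|ps| ≤ n`, primes `< 2^(n+1)`). Pure arithmetic: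

* sizes: `LD ≤ 4n+9`, `size cap ≤ 10n+28`, `hB < 2^(20n+70) ≤ 2^(LB−2)`, `(hB+1)^(log₂ hB+2) ≤ 2^(LB²)`
  (`csp_LD_le`, `csp_size_cap_le`, `csp_hB_lt`, `csp_hB_succ_pow_le`);
* the window / digit / grid exponent counts `2u ≤ 2^(e₆+9+LB+size(T+1))`, `hB³(2u)^T 2^(s+e₆+40) ≤ 2^ℓe`,
  `2⁵(27a²b²)⁶ hB 2^(2e₆+16) ≤ 2^s`, the `K₀` floor bounds and `(4K₀+2)(2u/2^ℓe)hB² < 1`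
  (`csp_two_u_le`, `csp_key`, `csp_grid`, `csp_K0_mul_le`, `csp_le_two_K0_mul`, `csp_post`);
* the layout budget `s + ℓe·T + ℓκ ≤ (Z+1)²` (`csp_budget`, from the abstract `csp_budget_arith`: everything is
  `O(n² Z)` against `Z² ≥ 2²⁰ (n+8)² Z`);
* the three real-number budget lines on abstract sizes (`csp_unit_budget_arith`: `(Z+4)² < 4^size(Z+4)`;
  `csp_gen_budget_arith`: `q ≤ 2/3`, `q² ≤ 1/2`, `400(Z+4)² ≥ LB²+6`; `csp_kitaev_arith`: `1600/2¹⁹ ≤ 1/64`);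
* the registered conjunction `classStage_params`.

Design: every real inequality and the layout budget are first proved on plain natural-number variables and then
instantiated, so that no tactic unifies through the definitions `e6`/`Z`/`hB` (whose unfolding to numerals is
expensive).
-/

-- the problem namespace repeats the summit name (`QuantumAdvantage.QuantumAdvantage`)
set_option linter.dupNamespace false

namespace Summit.QuantumAdvantage.QuantumAdvantage.Theorems.LinnikCubicClassGroups

open Literature.Computability.Cryptography.CubicClassStageParams

/-! ### Generic size facts -/

/-- `x < 2^(n+1)` gives `x² < 2^(2n+2)`. -/
theorem csp_sq_lt {x n : ℕ} (h : x < 2 ^ (n + 1)) : x ^ 2 < 2 ^ (2 * n + 2) := by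
  calc x ^ 2 < (2 ^ (n + 1)) ^ 2 := Nat.pow_lt_pow_left h two_ne_zero
    _ = 2 ^ (2 * n + 2) := by ring

/-- A member of a list is at most its `foldr max 0`. -/
theorem csp_le_foldr_max {p : ℕ} : ∀ {ps : List ℕ}, p ∈ ps → p ≤ ps.foldr max 0
  | [], h => absurd h List.not_mem_nil
  | q :: qs, h => by
      rw [List.foldr_cons]
      rcases List.mem_cons.1 h with rfl | h
      · exact le_max_left _ _
      · exact (csp_le_foldr_max h).trans (le_max_right _ _)

/-- `foldr max 0` of a list of numbers below a positive bound is below the bound. -/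
theorem csp_foldr_max_lt {B : ℕ} (hB : 0 < B) : ∀ {ps : List ℕ}, (∀ p ∈ ps, p < B) → ps.foldr max 0 < B
  | [], _ => by simpa using hB
  | q :: qs, h => by
      rw [List.foldr_cons]
      exact max_lt (h q List.mem_cons_self) (csp_foldr_max_lt hB fun p hp => h p (List.mem_cons_of_mem q hp))

/-! ### The discriminant size `LD`, the clamp `cap` and the class-number bound `hB` -/

/-- `27 a² b² < 2^(4n+9)` for `a, b < 2^(n+1)`. -/
theorem csp_disc_lt {n a b : ℕ} (ha : a < 2 ^ (n + 1)) (hb : b < 2 ^ (n + 1)) :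
    27 * a ^ 2 * b ^ 2 < 2 ^ (4 * n + 9) := by
  have ha2 := csp_sq_lt ha
  have hb2 := csp_sq_lt hb
  have h1 : 27 * a ^ 2 < 32 * 2 ^ (2 * n + 2) := by omega
  calc 27 * a ^ 2 * b ^ 2 < 32 * 2 ^ (2 * n + 2) * 2 ^ (2 * n + 2) := Nat.mul_lt_mul'' h1 hb2
    _ = 2 ^ (4 * n + 9) := by ring

/-- `LD a b ≤ 4n + 9`. -/
theorem csp_LD_le {n a b : ℕ} (ha : a < 2 ^ (n + 1)) (hb : b < 2 ^ (n + 1)) : LD a b ≤ 4 * n + 9 :=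
  Nat.size_le.2 (csp_disc_lt ha hb)

/-- `size cap ≤ 10n + 28`. -/
theorem csp_size_cap_le {n a b : ℕ} {ps : List ℕ} (ha : a < 2 ^ (n + 1)) (hb : b < 2 ^ (n + 1))
    (hps : ∀ p ∈ ps, p < 2 ^ (n + 1)) : Nat.size (capOf a b ps) ≤ 10 * n + 28 := by
  have hmax : ps.foldr max 0 + 1 ≤ 2 ^ (n + 1) :=
    Nat.succ_le_of_lt (csp_foldr_max_lt (Nat.pow_pos two_pos) hps)
  have h1 : 243 * a ^ 2 * b ^ 2 < 2 ^ (4 * n + 13) := by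
    have := csp_disc_lt ha hb
    calc 243 * a ^ 2 * b ^ 2 = 9 * (27 * a ^ 2 * b ^ 2) := by ring
      _ < 16 * 2 ^ (4 * n + 9) := by omega
      _ = 2 ^ (4 * n + 13) := by ring
  have h2 : 243 * a ^ 2 * b ^ 2 * (ps.foldr max 0 + 1) < 2 ^ (5 * n + 14) :=
    calc 243 * a ^ 2 * b ^ 2 * (ps.foldr max 0 + 1) ≤ 243 * a ^ 2 * b ^ 2 * 2 ^ (n + 1) :=
        Nat.mul_le_mul_left _ hmax
      _ < 2 ^ (4 * n + 13) * 2 ^ (n + 1) := Nat.mul_lt_mul_of_pos_right h1 (Nat.pow_pos two_pos)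
      _ = 2 ^ (5 * n + 14) := by ring
  unfold capOf
  rw [Nat.size_le]
  calc (243 * a ^ 2 * b ^ 2 * (ps.foldr max 0 + 1)) ^ 2 < (2 ^ (5 * n + 14)) ^ 2 :=
      Nat.pow_lt_pow_left h2 two_ne_zero
    _ = 2 ^ (10 * n + 28) := by ring

/-- `hB m < 2^(20n+70)` for `m < 2^(n+1)`. -/
theorem csp_hB_lt {n mx : ℕ} (h : mx < 2 ^ (n + 1)) : hB mx < 2 ^ (20 * n + 70) := by
  have h1 : 27 * mx ^ 2 < 2 ^ (2 * n + 7) := by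
    have := csp_sq_lt h
    calc 27 * mx ^ 2 < 32 * 2 ^ (2 * n + 2) := by omega
      _ = 2 ^ (2 * n + 7) := by ring
  calc hB mx = (27 * mx ^ 2) ^ 10 := rfl
    _ < (2 ^ (2 * n + 7)) ^ 10 := Nat.pow_lt_pow_left h1 (by norm_num)
    _ = 2 ^ (20 * n + 70) := by ring

/-- `hB m < 2^(LB n − 2)`. -/
theorem csp_hB_lt_LB {n mx : ℕ} (h : mx < 2 ^ (n + 1)) : hB mx < 2 ^ (LB n - 2) :=
  (csp_hB_lt h).trans_le (Nat.pow_le_pow_right two_pos (by unfold LB; omega))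

/-- `hB m ≤ 2^(LB n)`. -/
theorem csp_hB_le {n mx : ℕ} (h : mx < 2 ^ (n + 1)) : hB mx ≤ 2 ^ LB n :=
  (csp_hB_lt h).le.trans (Nat.pow_le_pow_right two_pos (by unfold LB; omega))

/-- `1 ≤ hB m` for `m ≥ 1`. -/
theorem csp_one_le_hB {mx : ℕ} (h : 1 ≤ mx) : 1 ≤ hB mx :=
  Nat.one_le_pow _ _ (Nat.mul_pos (by norm_num) (Nat.pow_pos h))

/-- `(hB+1)^(log₂ hB + 2) ≤ 2^(LB·LB)`. -/
theorem csp_hB_succ_pow_le {n mx : ℕ} (h : mx < 2 ^ (n + 1)) :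
    (hB mx + 1) ^ (Nat.log 2 (hB mx) + 2) ≤ 2 ^ (LB n * LB n) := by
  have hlt := csp_hB_lt_LB h
  have hLB : 75 ≤ LB n := by unfold LB; omega
  have hlog : Nat.log 2 (hB mx) + 2 ≤ LB n := by
    rcases Nat.eq_zero_or_pos (hB mx) with h0 | h0
    · rw [h0, Nat.log_zero_right]; omega
    · have := Nat.log_lt_of_lt_pow h0.ne' hlt; omega
  have h1 : hB mx + 1 ≤ 2 ^ LB n :=
    (Nat.succ_le_of_lt hlt).trans (Nat.pow_le_pow_right two_pos (Nat.sub_le _ _))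
  calc (hB mx + 1) ^ (Nat.log 2 (hB mx) + 2) ≤ (hB mx + 1) ^ LB n := Nat.pow_le_pow_right (Nat.succ_pos _) hlog
    _ ≤ (2 ^ LB n) ^ LB n := Nat.pow_le_pow_left h1 _
    _ = 2 ^ (LB n * LB n) := by rw [← pow_mul]

/-! ### The window, the digit size and the grid -/

/-- `2u ≤ 2^(e₆ + 9 + LB + size(T+1))`. -/
theorem csp_two_u_le {n mx : ℕ} (ps : List ℕ) (h : mx < 2 ^ (n + 1)) :
    2 * uOf n mx ps ≤ 2 ^ (e6 n + 9 + LB n + Nat.size (Tp ps + 1)) := by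
  unfold uOf
  calc 2 * (2 ^ (e6 n + 8) * hB mx * (Tp ps + 1)) = 2 ^ (e6 n + 9) * (hB mx * (Tp ps + 1)) := by ring
    _ ≤ 2 ^ (e6 n + 9) * (2 ^ LB n * 2 ^ Nat.size (Tp ps + 1)) :=
        Nat.mul_le_mul_left _ (Nat.mul_le_mul (csp_hB_le h) (Nat.lt_size_self _).le)
    _ = 2 ^ (e6 n + 9 + LB n + Nat.size (Tp ps + 1)) := by ring

/-- KEY: `hB³ (2u)^T 2^(s+e₆+40) ≤ 2^ℓe`. -/
theorem csp_key {n mx : ℕ} (a b : ℕ) (ps : List ℕ) (h : mx < 2 ^ (n + 1)) :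
    hB mx ^ 3 * (2 * uOf n mx ps) ^ Tp ps * 2 ^ (sOf n a b + e6 n + 40) ≤ 2 ^ leOf n a b ps := by
  have hB' := csp_hB_le (n := n) h
  have hu := csp_two_u_le ps h
  have hm : (e6 n + 9 + LB n + Nat.size (Tp ps + 1)) * Tp ps ≤
      (Tp ps + 1) * (e6 n + 10 + LB n + Nat.size (Tp ps + 1)) := by
    rw [mul_comm]; exact Nat.mul_le_mul (Nat.le_succ _) (by omega)
  calc hB mx ^ 3 * (2 * uOf n mx ps) ^ Tp ps * 2 ^ (sOf n a b + e6 n + 40)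
      ≤ (2 ^ LB n) ^ 3 * (2 ^ (e6 n + 9 + LB n + Nat.size (Tp ps + 1))) ^ Tp ps * 2 ^ (sOf n a b + e6 n + 40) :=
        Nat.mul_le_mul_right _ (Nat.mul_le_mul (Nat.pow_le_pow_left hB' 3) (Nat.pow_le_pow_left hu _))
    _ = 2 ^ (LB n * 3 + (e6 n + 9 + LB n + Nat.size (Tp ps + 1)) * Tp ps + (sOf n a b + e6 n + 40)) := by
        rw [← pow_mul, ← pow_mul, ← pow_add, ← pow_add]
    _ ≤ 2 ^ leOf n a b ps := Nat.pow_le_pow_right two_pos (by unfold leOf; omega)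

/-- `2^5 (27a²b²)^6 hB 2^(2e₆+16) ≤ 2^s`. -/
theorem csp_grid {n mx : ℕ} (a b : ℕ) (h : mx < 2 ^ (n + 1)) :
    2 ^ 5 * (27 * a ^ 2 * b ^ 2) ^ 6 * hB mx * 2 ^ (2 * e6 n + 16) ≤ 2 ^ sOf n a b := by
  have hd : 27 * a ^ 2 * b ^ 2 ≤ 2 ^ LD a b := (Nat.lt_size_self _).le
  have h6 : (27 * a ^ 2 * b ^ 2) ^ 6 ≤ 2 ^ (LD a b * 6) := by rw [pow_mul]; exact Nat.pow_le_pow_left hd 6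
  calc 2 ^ 5 * (27 * a ^ 2 * b ^ 2) ^ 6 * hB mx * 2 ^ (2 * e6 n + 16)
      ≤ 2 ^ 5 * 2 ^ (LD a b * 6) * 2 ^ LB n * 2 ^ (2 * e6 n + 16) :=
        Nat.mul_le_mul_right _ (Nat.mul_le_mul (Nat.mul_le_mul_left _ h6) (csp_hB_le h))
    _ = 2 ^ (5 + LD a b * 6 + LB n + (2 * e6 n + 16)) := by rw [← pow_add, ← pow_add, ← pow_add]
    _ ≤ 2 ^ sOf n a b := Nat.pow_le_pow_right two_pos (by unfold sOf; omega)

/-- The window denominator `2^(e₆+8) hB ≤ 2^s`. -/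
theorem csp_den_le {n mx : ℕ} (a b : ℕ) (h : mx < 2 ^ (n + 1)) : 2 ^ (e6 n + 8) * hB mx ≤ 2 ^ sOf n a b :=
  calc 2 ^ (e6 n + 8) * hB mx ≤ 2 ^ (e6 n + 8) * 2 ^ LB n := Nat.mul_le_mul_left _ (csp_hB_le h)
    _ = 2 ^ (e6 n + 8 + LB n) := (pow_add 2 _ _).symm
    _ ≤ 2 ^ sOf n a b := Nat.pow_le_pow_right two_pos (by unfold sOf; omega)

/-- `K₀ · (2^(e₆+8) hB) ≤ 2^s`. -/
theorem csp_K0_mul_le (n a b mx : ℕ) : K0Of n a b mx * (2 ^ (e6 n + 8) * hB mx) ≤ 2 ^ sOf n a b :=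
  Nat.div_mul_le_self _ _

/-- `2^s ≤ 2 K₀ (2^(e₆+8) hB)` (the floor loses at most half). -/
theorem csp_le_two_K0_mul {n mx : ℕ} (a b : ℕ) (h1 : 1 ≤ mx) (h : mx < 2 ^ (n + 1)) :
    2 ^ sOf n a b ≤ 2 * K0Of n a b mx * (2 ^ (e6 n + 8) * hB mx) := by
  unfold K0Of
  set d := 2 ^ (e6 n + 8) * hB mx with hd
  set x := 2 ^ sOf n a b with hx
  have hdpos : 0 < d := Nat.mul_pos (Nat.pow_pos two_pos) (csp_one_le_hB h1)
  have hdx : d ≤ x := csp_den_le a b h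
  have hq : 1 ≤ x / d := (Nat.le_div_iff_mul_le hdpos).2 (by rwa [one_mul])
  have h2 := Nat.div_add_mod x d
  have h3 := Nat.mod_lt x hdpos
  have h4 : d ≤ d * (x / d) := Nat.le_mul_of_pos_right _ hq
  have h5 : 2 * (x / d) * d = 2 * (d * (x / d)) := by ring
  omega

/-- `4 K₀ + 2 ≤ 2^(s+3)`. -/
theorem csp_four_K0_le (n a b mx : ℕ) : 4 * K0Of n a b mx + 2 ≤ 2 ^ (sOf n a b + 3) := by
  have h1 : K0Of n a b mx ≤ 2 ^ sOf n a b := Nat.div_le_self _ _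
  have h2 : 1 ≤ 2 ^ sOf n a b := Nat.one_le_two_pow
  rw [pow_add]; omega

/-! ### The layout fits into the block `(Z+1)²` -/

/-- The arithmetic of the layout budget, on abstract sizes. -/
theorem csp_budget_arith (n L E D sT sL sC Zv : ℕ) (hL : L ≤ n) (hZ1 : 2 ^ 23 * (n + 8) ≤ Zv)
    (hZ2 : 2 ^ 20 * (n + 8) ^ 2 ≤ Zv) (hE : E ≤ 2 * Zv + 28) (hD : D ≤ 4 * n + 9) (hsT : sT ≤ 3 * L + 1)
    (hsL : sL ≤ n) (hsC : sC ≤ 10 * n + 28) :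
    6 * D + (20 * n + 75) + 2 * E + 60 +
      (3 * (20 * n + 75) + (3 * L + 1) * (E + 10 + (20 * n + 75) + sT) + (6 * D + (20 * n + 75) + 2 * E + 60) +
        E + 40) * (3 * L) +
      L * (24 * (sC + 2) * (50 + 2 * E + sL)) ≤ (Zv + 1) ^ 2 := by
  have hS : 6 * D + (20 * n + 75) + 2 * E + 60 ≤ 5 * Zv := by omega
  have hY : E + 10 + (20 * n + 75) + sT ≤ 3 * Zv := by omega
  have hT1 : 3 * L + 1 ≤ 4 * (n + 8) := by omega
  have h1 : (3 * L + 1) * (E + 10 + (20 * n + 75) + sT) ≤ 4 * (n + 8) * (3 * Zv) := Nat.mul_le_mul hT1 hY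
  have h2 : 8 * Zv ≤ (n + 8) * Zv := Nat.mul_le_mul_right _ (by omega)
  have hl : 3 * (20 * n + 75) + (3 * L + 1) * (E + 10 + (20 * n + 75) + sT) +
      (6 * D + (20 * n + 75) + 2 * E + 60) + E + 40 ≤ 13 * (n + 8) * Zv := by nlinarith
  have hlT : (3 * (20 * n + 75) + (3 * L + 1) * (E + 10 + (20 * n + 75) + sT) +
      (6 * D + (20 * n + 75) + 2 * E + 60) + E + 40) * (3 * L) ≤ 13 * (n + 8) * Zv * (3 * (n + 8)) :=
    Nat.mul_le_mul hl (by omega)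
  have hC2 : sC + 2 ≤ 10 * (n + 8) := by omega
  have hW : 50 + 2 * E + sL ≤ 5 * Zv := by omega
  have hlb : 24 * (sC + 2) * (50 + 2 * E + sL) ≤ 24 * (10 * (n + 8)) * (5 * Zv) :=
    Nat.mul_le_mul (Nat.mul_le_mul_left 24 hC2) hW
  have hlk : L * (24 * (sC + 2) * (50 + 2 * E + sL)) ≤ (n + 8) * (24 * (10 * (n + 8)) * (5 * Zv)) :=
    Nat.mul_le_mul (by omega) hlb
  have h3 : 2 ^ 20 * (n + 8) ^ 2 * Zv ≤ Zv * Zv := Nat.mul_le_mul_right _ hZ2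
  have h4 : Zv ≤ (n + 8) ^ 2 * Zv := Nat.le_mul_of_pos_left _ (by positivity)
  nlinarith

/-- The layout budget: `s + ℓe·T + ℓκ ≤ (Z+1)²`. -/
theorem csp_budget {n a b : ℕ} {ps : List ℕ} (ha : a < 2 ^ (n + 1)) (hb : b < 2 ^ (n + 1))
    (hlen : ps.length ≤ n) (hps : ∀ p ∈ ps, p < 2 ^ (n + 1)) :
    sOf n a b + leOf n a b ps * Tp ps + lkOf n a b ps ≤ (Z n + 1) ^ 2 := by
  have h8 : 8 ≤ n + 8 := Nat.le_add_left 8 n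
  have hM3 : 64 * (n + 8) ≤ (n + 8) ^ 3 :=
    calc 64 * (n + 8) = 8 * 8 * (n + 8) := by ring
      _ ≤ (n + 8) * (n + 8) * (n + 8) := Nat.mul_le_mul_right _ (Nat.mul_le_mul h8 h8)
      _ = (n + 8) ^ 3 := by ring
  have hM2 : 8 * (n + 8) ^ 2 ≤ (n + 8) ^ 3 :=
    calc 8 * (n + 8) ^ 2 ≤ (n + 8) * (n + 8) ^ 2 := Nat.mul_le_mul_right _ h8
      _ = (n + 8) ^ 3 := by ring
  have hZ1 : 2 ^ 23 * (n + 8) ≤ Z n :=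
    calc 2 ^ 23 * (n + 8) = 2 ^ 17 * (64 * (n + 8)) := by ring
      _ ≤ 2 ^ 17 * (n + 8) ^ 3 := Nat.mul_le_mul_left _ hM3
  have hZ2 : 2 ^ 20 * (n + 8) ^ 2 ≤ Z n :=
    calc 2 ^ 20 * (n + 8) ^ 2 = 2 ^ 17 * (8 * (n + 8) ^ 2) := by ring
      _ ≤ 2 ^ 17 * (n + 8) ^ 3 := Nat.mul_le_mul_left _ hM2
  have hE : e6 n ≤ 2 * Z n + 28 := by
    have : Nat.size (Z n + 4) ≤ Z n + 4 := Nat.size_le.2 Nat.lt_two_pow_self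
    unfold e6; omega
  have hsT : Nat.size (3 * ps.length + 1) ≤ 3 * ps.length + 1 := Nat.size_le.2 Nat.lt_two_pow_self
  have hsL : Nat.size ps.length ≤ n := (Nat.size_le.2 Nat.lt_two_pow_self).trans hlen
  have hsC := csp_size_cap_le ha hb hps
  unfold lkOf lbOf leOf sOf Tp LB
  exact csp_budget_arith n ps.length (e6 n) (LD a b) _ _ _ (Z n) hlen hZ1 hZ2 hE (csp_LD_le ha hb) hsT
    hsL hsC

/-! ### The real-number budgets, on abstract sizes -/

/-- Post-processing: `(4K+2) (2u/2^ℓ) B² < 1` from the exponent count. -/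
theorem csp_post_arith (K u l B s X L : ℕ) (hK : 4 * K + 2 ≤ 2 ^ (s + 3)) (hu : 2 * u ≤ 2 ^ X)
    (hB2 : B ^ 2 ≤ 2 ^ (L * 2)) (hexp : s + 3 + X + L * 2 < l) :
    (4 * (K : ℝ) + 2) * ((2 * u : ℝ) / 2 ^ l) * (B : ℝ) ^ 2 < 1 := by
  have e1 : (4 * (K : ℝ) + 2) ≤ (2 : ℝ) ^ (s + 3) := by exact_mod_cast hK
  have e2 : (2 * (u : ℝ)) ≤ (2 : ℝ) ^ X := by exact_mod_cast hu
  have e3 : (B : ℝ) ^ 2 ≤ (2 : ℝ) ^ (L * 2) := by exact_mod_cast hB2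
  have hl : (0 : ℝ) < 2 ^ l := pow_pos two_pos _
  have step1 : (4 * (K : ℝ) + 2) * ((2 * u : ℝ) / 2 ^ l) ≤ (2 : ℝ) ^ (s + 3) * ((2 : ℝ) ^ X / 2 ^ l) :=
    mul_le_mul e1 (div_le_div_of_nonneg_right e2 hl.le) (by positivity) (by positivity)
  have step2 : (4 * (K : ℝ) + 2) * ((2 * u : ℝ) / 2 ^ l) * (B : ℝ) ^ 2 ≤
      (2 : ℝ) ^ (s + 3) * ((2 : ℝ) ^ X / 2 ^ l) * (2 : ℝ) ^ (L * 2) :=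
    mul_le_mul step1 e3 (by positivity) (by positivity)
  refine step2.trans_lt ?_
  rw [show (2 : ℝ) ^ (s + 3) * ((2 : ℝ) ^ X / 2 ^ l) * (2 : ℝ) ^ (L * 2) = (2 : ℝ) ^ (s + 3 + X + L * 2) / 2 ^ l by
    ring, div_lt_one hl]
  exact pow_lt_pow_right₀ (by norm_num) hexp

/-- The post-processing constraint `(4K₀+2) · (2u/2^ℓe) · hB² < 1`. -/
theorem csp_post {n mx : ℕ} (a b : ℕ) (ps : List ℕ) (h : mx < 2 ^ (n + 1)) :
    (4 * (K0Of n a b mx : ℝ) + 2) * ((2 * uOf n mx ps : ℝ) / 2 ^ leOf n a b ps) * (hB mx : ℝ) ^ 2 < 1 := by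
  have hB2 : hB mx ^ 2 ≤ 2 ^ (LB n * 2) := by rw [pow_mul]; exact Nat.pow_le_pow_left (csp_hB_le h) 2
  have hexp : sOf n a b + 3 + (e6 n + 9 + LB n + Nat.size (Tp ps + 1)) + LB n * 2 < leOf n a b ps := by
    have hY : e6 n + 10 + LB n + Nat.size (Tp ps + 1) ≤
        (Tp ps + 1) * (e6 n + 10 + LB n + Nat.size (Tp ps + 1)) := Nat.le_mul_of_pos_left _ (Nat.succ_pos _)
    unfold leOf; omega
  exact csp_post_arith _ _ _ _ _ _ _ (csp_four_K0_le n a b mx) (csp_two_u_le ps h) hB2 hexp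

/-- `2^-(40+2E) + 2^-(30+2E) ≤ 2^-(2E+8)`. -/
theorem csp_eps_arith (E : ℕ) :
    ((1 : ℝ) / 2) ^ (40 + 2 * E) + ((1 : ℝ) / 2) ^ (30 + 2 * E) ≤ ((1 : ℝ) / 2) ^ (2 * E + 8) := by
  have h1 : ((1 : ℝ) / 2) ^ (40 + 2 * E) = ((1 : ℝ) / 2) ^ (2 * E + 8) * ((1 : ℝ) / 2) ^ 32 := by
    rw [← pow_add]; congr 1; omega
  have h2 : ((1 : ℝ) / 2) ^ (30 + 2 * E) = ((1 : ℝ) / 2) ^ (2 * E + 8) * ((1 : ℝ) / 2) ^ 22 := by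
    rw [← pow_add]; congr 1; omega
  rw [h1, h2, ← mul_add]
  exact mul_le_of_le_one_right (by positivity) (by norm_num)

/-- The inaccurate-unit budget `3200 (z+4)² 2^-(2s+20) ≤ 1/64` for `z + 4 < 2^s`. -/
theorem csp_unit_budget_arith (z s : ℕ) (hz : z + 4 < 2 ^ s) :
    2 * (800 * ((z : ℝ) + 4) ^ 2) * (((1 : ℝ) / 2) ^ (2 * s + 20) + ((1 : ℝ) / 2) ^ (2 * s + 20)) ≤ 1 / 64 := by
  have hz' : ((z : ℝ) + 4) ≤ (2 : ℝ) ^ s := by exact_mod_cast hz.le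
  have ht : ((z : ℝ) + 4) * ((1 : ℝ) / 2) ^ s ≤ 1 := by
    rw [one_div_pow, mul_one_div, div_le_one (by positivity)]; exact hz'
  have ht0 : (0 : ℝ) ≤ ((z : ℝ) + 4) * ((1 : ℝ) / 2) ^ s := by positivity
  calc 2 * (800 * ((z : ℝ) + 4) ^ 2) * (((1 : ℝ) / 2) ^ (2 * s + 20) + ((1 : ℝ) / 2) ^ (2 * s + 20))
      = 3200 * (((z : ℝ) + 4) * ((1 : ℝ) / 2) ^ s) ^ 2 * ((1 : ℝ) / 2) ^ 20 := by ring
    _ ≤ 3200 * (1 : ℝ) ^ 2 * ((1 : ℝ) / 2) ^ 20 := by gcongr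
    _ ≤ 1 / 64 := by norm_num

/-- The generation budget `(B+1)^(log₂ B+2) · q^(800 (z+4)²) ≤ 1/64`, `q = (9/8)²/2 + 6·2^-E ≤ 2/3`. -/
theorem csp_gen_budget_arith (B L z E : ℕ) (hA : (B + 1) ^ (Nat.log 2 B + 2) ≤ 2 ^ (L * L))
    (hm : L * L + 6 ≤ 400 * (z + 4) ^ 2) (hE : 20 ≤ E) :
    ((B : ℝ) + 1) ^ (Nat.log 2 B + 2) *
        ((1 + (1 : ℝ) / 8) ^ 2 / 2 + 3 * (((1 : ℝ) / 2) ^ E + ((1 : ℝ) / 2) ^ E)) ^ (800 * (z + 4) ^ 2) ≤ 1 / 64 := by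
  set q : ℝ := (1 + (1 : ℝ) / 8) ^ 2 / 2 + 3 * (((1 : ℝ) / 2) ^ E + ((1 : ℝ) / 2) ^ E) with hq
  have hε : ((1 : ℝ) / 2) ^ E ≤ ((1 : ℝ) / 2) ^ 20 := pow_le_pow_of_le_one (by norm_num) (by norm_num) hE
  have hq0 : 0 ≤ q := by positivity
  have hq1 : q ≤ 2 / 3 := by rw [hq]; nlinarith [hε]
  have hq2 : q ^ 2 ≤ 1 / 2 := (pow_le_pow_left₀ hq0 hq1 2).trans (by norm_num)
  have hA' : ((B : ℝ) + 1) ^ (Nat.log 2 B + 2) ≤ (2 : ℝ) ^ (L * L) := by exact_mod_cast hA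
  have hB' : q ^ (800 * (z + 4) ^ 2) ≤ ((1 : ℝ) / 2) ^ (400 * (z + 4) ^ 2) := by
    rw [show 800 * (z + 4) ^ 2 = 2 * (400 * (z + 4) ^ 2) by ring, pow_mul]
    exact pow_le_pow_left₀ (sq_nonneg q) hq2 _
  have hC : ((1 : ℝ) / 2) ^ (400 * (z + 4) ^ 2) ≤ ((1 : ℝ) / 2) ^ (L * L + 6) :=
    pow_le_pow_of_le_one (by norm_num) (by norm_num) hm
  calc ((B : ℝ) + 1) ^ (Nat.log 2 B + 2) * q ^ (800 * (z + 4) ^ 2)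
      ≤ (2 : ℝ) ^ (L * L) * ((1 : ℝ) / 2) ^ (L * L + 6) :=
        mul_le_mul hA' (hB'.trans hC) (by positivity) (by positivity)
    _ = 1 / 64 := by rw [pow_add, ← mul_assoc, ← mul_pow]; norm_num

/-- `LB² + 6 ≤ 400 (Z+4)²`. -/
theorem csp_LB_sq_le (n : ℕ) : LB n * LB n + 6 ≤ 400 * (Z n + 4) ^ 2 := by
  have hLB : LB n ≤ 20 * (n + 8) := by unfold LB; omega
  have h1 : LB n * LB n ≤ 20 * (n + 8) * (20 * (n + 8)) := Nat.mul_le_mul hLB hLB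
  have h2 : (n + 8) ^ 2 ≤ (n + 8) ^ 3 := Nat.pow_le_pow_right (Nat.succ_pos _) (by norm_num)
  have h3 : (n + 8) ^ 3 ≤ Z n := Nat.le_mul_of_pos_left _ (by norm_num)
  have h4 : Z n + 1 ≤ (Z n + 4) ^ 2 := by nlinarith
  nlinarith

/-- The Kitaev budget `1600 (z+4)² · 2^-19/(z+4)² ≤ 1/64`. -/
theorem csp_kitaev_arith (z : ℕ) :
    (1600 * ((z : ℝ) + 4) ^ 2) * (1 / (2 ^ 19 * ((z : ℝ) + 4) ^ 2)) ≤ 1 / 64 := by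
  have hpos : (0 : ℝ) < ((z : ℝ) + 4) ^ 2 := by positivity
  rw [show (1600 * ((z : ℝ) + 4) ^ 2) * (1 / (2 ^ 19 * ((z : ℝ) + 4) ^ 2)) = 1600 / 2 ^ 19 by
    field_simp]
  norm_num

/-! ### The registered statement -/

/-- **S5b-ASM `classStage_params`**: the cross-constraints of the explicit parameters of the class-group stage, for
input data `1 ≤ a, b`, `a, b, m < 2^(n+1)`, `1 ≤ m` (the radicand; `hB 0 = 0` would break `1 ≤ hB` and the `K₀` floor
bound), `|ps| ≤ n`, primes `< 2^(n+1)`. (Registered signature + the hypothesis `1 ≤ mx`.) -/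
theorem classStage_params :
    ∀ (n a b mx : ℕ) (ps : List ℕ), 1 ≤ a → 1 ≤ b → a < 2 ^ (n + 1) → b < 2 ^ (n + 1) → 1 ≤ mx →
      mx < 2 ^ (n + 1) → ps.length ≤ n → (∀ p ∈ ps, p < 2 ^ (n + 1)) →
      20 ≤ leOf n a b ps ∧
      lkOf n a b ps ≤ topOf n a b ps ∧
      topOf n a b ps + sOf n a b + leOf n a b ps * Tp ps = (Z n + 1) ^ 2 ∧
      6 * LD a b + 50 + 2 * e6 n ≤ sOf n a b ∧
      (243 * a ^ 2 * b ^ 2) ^ 2 ≤ capOf a b ps ∧ (∀ p ∈ ps, (243 * a ^ 2 * b ^ 2 * (p + 1)) ^ 2 ≤ capOf a b ps) ∧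
      1 ≤ hB mx ∧ hB mx < 2 ^ (LB n - 2) ∧
      ((1 : ℝ) / 2) ^ (40 + 2 * e6 n) + ((1 : ℝ) / 2) ^ (30 + 2 * e6 n) ≤ ((1 : ℝ) / 2) ^ (2 * e6 n + 8) ∧
      hB mx ^ 3 * (2 * uOf n mx ps) ^ Tp ps * 2 ^ (sOf n a b + e6 n + 40) ≤ 2 ^ leOf n a b ps ∧
      2 ^ 5 * (27 * a ^ 2 * b ^ 2) ^ 6 * hB mx * 2 ^ (2 * e6 n + 16) ≤ 2 ^ sOf n a b ∧
      K0Of n a b mx * (2 ^ (e6 n + 8) * hB mx) ≤ 2 ^ sOf n a b ∧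
      2 ^ sOf n a b ≤ 2 * K0Of n a b mx * (2 ^ (e6 n + 8) * hB mx) ∧
      (4 * (K0Of n a b mx : ℝ) + 2) * ((2 * uOf n mx ps : ℝ) / 2 ^ leOf n a b ps) * (hB mx : ℝ) ^ 2 < 1 ∧
      2 * (800 * ((Z n : ℝ) + 4) ^ 2) * (((1 : ℝ) / 2) ^ e6 n + ((1 : ℝ) / 2) ^ e6 n) ≤ 1 / 64 ∧
      ((hB mx : ℝ) + 1) ^ (Nat.log 2 (hB mx) + 2) *
          ((1 + (1 : ℝ) / 8) ^ 2 / 2 + 3 * (((1 : ℝ) / 2) ^ e6 n + ((1 : ℝ) / 2) ^ e6 n)) ^ (800 * (Z n + 4) ^ 2) ≤ 1 / 64 ∧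
      (1600 * ((Z n : ℝ) + 4) ^ 2) * (1 / (2 ^ 19 * ((Z n : ℝ) + 4) ^ 2)) ≤ 1 / 64 := by
  intro n a b mx ps _ _ ha hb hmx1 hmx hlen hps
  have hbud := csp_budget ha hb hlen hps
  refine ⟨?_, ?_, ?_, ?_, ?_, ?_, csp_one_le_hB hmx1, csp_hB_lt_LB hmx, csp_eps_arith _, csp_key a b ps hmx,
    csp_grid a b hmx, csp_K0_mul_le n a b mx, csp_le_two_K0_mul a b hmx1 hmx, csp_post a b ps hmx,
    csp_unit_budget_arith (Z n) (Nat.size (Z n + 4)) (Nat.lt_size_self _),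
    csp_gen_budget_arith (hB mx) (LB n) (Z n) (e6 n) (csp_hB_succ_pow_le hmx) (csp_LB_sq_le n)
      (by unfold e6; omega),
    csp_kitaev_arith _⟩
  · unfold leOf; omega
  · unfold topOf; omega
  · unfold topOf; omega
  · unfold sOf; omega
  · exact Nat.pow_le_pow_left (Nat.le_mul_of_pos_right _ (Nat.succ_pos _)) 2
  · intro p hp
    exact Nat.pow_le_pow_left (Nat.mul_le_mul_left _ (Nat.succ_le_succ (csp_le_foldr_max hp))) 2

end Summit.QuantumAdvantage.QuantumAdvantage.Theorems.LinnikCubicClassGroups
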